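/-
Copyright: the b2b-balaban T⁴-continuum CRUX team, row NE7b leaf lineage `t4-ne7b-formalise-leaf-05` (gen 157). Project licence.
-/
import Mathlib.Analysis.SpecialFunctions.Pow.Real
import Mathlib.Algebra.BigOperators.Ring.Finset
import Mathlib.Logic.Equiv.Defs

/-!
# THE ONE-AXIS TENT PARTITION ON A CHAIN OF BLOCKS: `φ_s(t, r) = [t = s](1 − r∕M) + [σt = s](r∕M)` — `Σ_s φ_s = 1`, `0 ≤ φ_s ≤ 1`, at most two cubes alive at a
# site, and every chain step (`r → r+1` inside a block, `(t, M−1) → (σt, 0)` across) moves each `φ_s` by at most `1∕M` and the whole column by at most `√2∕M` in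
# `ℓ²(cubes)` — the elementary letters `…AdmissibleFloorLinearPartition` ∕ `…QuadraticPartitionOfUnity` consume, one axis (row NE7b, node U5c; residual (R2′)
# family (2), letter (ℓ1); kernel lemmas; a [folklore] data `def`)

Cell `pub-balaban`, sub-cell `t4`, spine estimate NE7b (`T4WeightBudget.RelWeightBound`; the cell's OWN estimate — NOT PRINTED in [Bałaban 1983–89],
NOT PROVED).  Crux-route work under `Spine/NE7b/`; NOTHING of Bałaban's is asserted; ONE [folklore] data definition (`tent`, the weight — no Bałaban object);
zero `sorry`; no `T4Continuum/Support` leaf (FREEZE (0)).  Imports: Mathlib only.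
PRIOR ART WITH A PRINTED LOCATOR (chair X-TPC leaf-04 g159, δ-X-TPC-1): print's tent partition of unity is [Balaban1988Convergent] (3.40) p. 275 (= [B14]; [B6] Sect. A's
`{h_□}` is its square-normalised form), and its CITED KERNEL HOME in the tree is `Literature.….Balaban1983to89.B14TentUnity` (`tentD` in `d` real coordinates:
`sum_window_tent_eq_one`, `tentD_decomposition_unity` (`Σ_z h_z = 1`), `tentD_nonneg`, `tentD_eq_zero_off_window`) and `….B14TentUnityTorus` (the same ON THE
DISCRETE TORUS: `tentZ`, `tentT`, `tentT_decomposition_unity`, `sum_tentZ_sub_eq_one`, and `residueEquiv (M) : ZMod M × ℤ ≃ ℤ` — the identification the NEXT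
file needs).  THIS file is NOT a restatement of those: it is the one-axis BLOCK × OFFSET chain form (`ZMod`-free, `K = 1` allowed) carrying the Lipschitz STEP
letters of §2–§3 (`≤ 1∕M` per cube, `≤ 2∕M²` in `ℓ²(cubes)` per chain step), which `B14TentUnity(Torus)` do not state; its §1 (sum ∕ support) overlaps them in
content, and a successor may re-prove §2–§3 for `B14TentUnityTorus.tentZ` directly and retire the seventh `tent` of the tree (six namesakes in other namespaces:
`B14Sect3.tent`, `T4BetaFlowWellPosed.tent`, …; no FQN clash).

WHY.  After `…AdmissibleFloorLinearPartition` (AFLP, this gen) the (h2) skeleton's partition input is a LINEAR partition `φ` with four elementary letters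
(`Σ_s φ_s(c) = 1`, `#{s : φ_s(c) ≠ 0} ≤ μ₀`, an `ℓ²(cubes)` variation bound on each term, a term multiplicity).  Print's `{h_□}` ([B6] Sect. A; SectE-interface-proof
Prop. 5.6: doubled `M`-cubes, `|∇h| ≤ c_h∕M`, `≤ 2^d` supports) is the normalisation (QPU) of a product over the `d` axes of ONE-AXIS tents.  THIS FILE is the
one-axis tent in a `ZMod`-free model: an axis is a chain of blocks `t ∈ ι` of `M` sites each (offset `r ∈ Fin M`), glued by a «next block» permutation `σ`
(the torus: `ι = ZMod K`, `σ = (· + 1)`; `K = 1` allowed), and the cube centred on block `s` weighs the site `(t, r)` by `[t = s](1 − r∕M) + [σt = s](r∕M)` — a SUM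
of two brackets (not an if-else), which is what makes `Σ_s φ_s = 1` hold for every `K` including the degenerate `σt = t`.

WHAT IS PROVED ([folklore]; `σ : ι ≃ ι`, `0 < M`):
* §1 `tent` (data def), `tent_sum` (`Σ_s φ_s(t,r) = 1`), `tent_nonneg`, `tent_le_one`, `tent_eq_zero_of_ne` (support ⊆ `{t, σt}`),
  **`card_alive_tent_le_two`** (`#{s : φ_s(t,r) ≠ 0} ≤ 2`).
* §2 chain steps, per cube: **`abs_tent_step_within`** (`|φ_s(t, r+1) − φ_s(t, r)| ≤ 1∕M`), **`abs_tent_step_across`** (`|φ_s(σt, 0) − φ_s(t, M−1)| ≤ 1∕M`).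
* §3 chain steps, in `ℓ²(cubes)`: **`sum_sq_tent_step_within`** ∕ **`sum_sq_tent_step_across`** (`Σ_s (Δφ_s)² ≤ 2∕M²`) — the per-step input of the
  path bound `Λ = ℓ·√2∕M` (triangle inequality in `ℓ²(cubes)` along a path of `ℓ` steps; the `d`-axis product and the path bound are the NEXT file).
* §4 toy: `ι = Fin 2`, `σ = swap`, `M = 2`: `Σ_s φ_s = 1` at every site (`example` via §1).

NOT HERE (honest): the `d`-axis product (`μ₀ = 2^d`), the path∕`ℓ¹`-diameter bound `Λ` on plaquette and averaging terms, the identification `ℤ∕KM ≃ ZMod K × Fin M`,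
bonds vs sites; anything of Bałaban's.  BY-NAME EFFECT ON THE WALL: NONE.  NE7b NOT PRINTED ∕ NOT PROVED; spine PROVED 0∕9; rung (B)+1 on ONE finite T⁴ —
NOT infinite volume, NOT the mass gap, NOT Clay.
HONEST DEPENDENCY: continuum YM on T⁴ ⇐ BetaPertH ∧ nine spine estimates (0/9 proved); BetaPertH ⇐ (D1) ∧ (D4) ∧ CAP+tail; G-an2-4 gates asym, D1 and NE2/3/4.
-/

set_option autoImplicit false

noncomputable section

open Finset

namespace Summit.QuantumFields.BalabanUV.T4Continuum.NE7b.TentPartitionChain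

variable {ι : Type*} [DecidableEq ι] {M : ℕ}

/-! ## §1 The tent weights: partition of unity, support of size two -/

/-- THE ONE-AXIS TENT WEIGHT of the cube centred on block `s` at the site `(t, r)` (block `t`, offset `r < M`): `[t = s](1 − r∕M) + [σt = s](r∕M)`
([folklore] data; no Bałaban object). -/
def tent (σ : ι ≃ ι) (M : ℕ) (s t : ι) (r : Fin M) : ℝ :=
  (if t = s then 1 - (r : ℝ) / M else 0) + (if σ t = s then (r : ℝ) / M else 0)

/-- **`Σ_s φ_s(t, r) = 1`** — for every «next block» permutation, including the degenerate `σt = t`. [folklore] -/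
theorem tent_sum [Fintype ι] (σ : ι ≃ ι) (t : ι) (r : Fin M) : ∑ s, tent σ M s t r = 1 := by
  simp only [tent, Finset.sum_add_distrib, Finset.sum_ite_eq, Finset.mem_univ, if_true]
  ring

/-- `r∕M ∈ [0, 1)` for `r : Fin M`. [folklore] -/
theorem div_offset_mem (r : Fin M) : 0 ≤ (r : ℝ) / M ∧ (r : ℝ) / M ≤ 1 := by
  have hM : (0 : ℝ) ≤ M := Nat.cast_nonneg M
  refine ⟨div_nonneg (Nat.cast_nonneg _) hM, ?_⟩
  rcases Nat.eq_zero_or_pos M with h0 | hpos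
  · subst h0; exact (Fin.elim0 r)
  · rw [div_le_one (by exact_mod_cast hpos)]
    exact_mod_cast r.2.le

/-- `0 ≤ φ_s(t, r)`. [folklore] -/
theorem tent_nonneg (σ : ι ≃ ι) (s t : ι) (r : Fin M) : 0 ≤ tent σ M s t r := by
  obtain ⟨h0, h1⟩ := div_offset_mem (M := M) r
  unfold tent
  refine add_nonneg ?_ ?_ <;> split_ifs <;> linarith

/-- `φ_s(t, r) ≤ 1` (a nonnegative family summing to one). [folklore] -/
theorem tent_le_one [Fintype ι] (σ : ι ≃ ι) (s t : ι) (r : Fin M) : tent σ M s t r ≤ 1 := by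
  rw [← tent_sum σ t r]
  exact Finset.single_le_sum (fun s' _ => tent_nonneg σ s' t r) (Finset.mem_univ s)

/-- Support: `φ_s(t, r) = 0` unless `s = t` or `s = σt`. [folklore] -/
theorem tent_eq_zero_of_ne (σ : ι ≃ ι) {s t : ι} (h1 : t ≠ s) (h2 : σ t ≠ s) (r : Fin M) : tent σ M s t r = 0 := by
  simp only [tent, if_neg h1, if_neg h2, add_zero]

/-- **AT MOST TWO CUBES ALIVE AT A SITE**: `#{s : φ_s(t, r) ≠ 0} ≤ 2` (the (mult) letter of QPU ∕ AFLP with `μ₀ = 2` per axis). [folklore] -/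
theorem card_alive_tent_le_two [Fintype ι] (σ : ι ≃ ι) (t : ι) (r : Fin M) :
    (Finset.univ.filter fun s => tent σ M s t r ≠ 0).card ≤ 2 := by
  have hsub : (Finset.univ.filter fun s => tent σ M s t r ≠ 0) ⊆ {t, σ t} := by
    intro s hs
    rw [Finset.mem_filter] at hs
    rw [Finset.mem_insert, Finset.mem_singleton]
    by_contra hn
    obtain ⟨ht, hσ⟩ := not_or.mp hn
    exact hs.2 (tent_eq_zero_of_ne σ (Ne.symm ht) (Ne.symm hσ) r)
  exact (Finset.card_le_card hsub).trans (Finset.card_insert_le _ _ |>.trans (by simp))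

/-! ## §2 Chain steps move each weight by at most `1∕M` -/

/-- **A STEP INSIDE A BLOCK**: `|φ_s(t, r+1) − φ_s(t, r)| ≤ 1∕M` (the two brackets move by `∓1∕M`). [folklore] -/
theorem abs_tent_step_within (σ : ι ≃ ι) (s t : ι) (r r' : Fin M) (h : (r' : ℕ) = r + 1) :
    |tent σ M s t r' - tent σ M s t r| ≤ 1 / M := by
  have hM : (0 : ℝ) < M := by exact_mod_cast (show 0 < M by have := r'.2; omega)
  have hr' : (r' : ℝ) = r + 1 := by exact_mod_cast h
  unfold tent
  rw [hr']
  split_ifs <;>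
  · rw [abs_le]; constructor <;> · field_simp; nlinarith [hM]

/-- **A STEP ACROSS A BLOCK BOUNDARY**: `|φ_s(σt, 0) − φ_s(t, M−1)| ≤ 1∕M` (`φ_s(σt, 0) = [σt = s]`, `φ_s(t, M−1) = [t = s]∕M + [σt = s](1 − 1∕M)`). [folklore] -/
theorem abs_tent_step_across (σ : ι ≃ ι) (s t : ι) (r0 rl : Fin M) (h0 : (r0 : ℕ) = 0) (hl : (rl : ℕ) + 1 = M) :
    |tent σ M s (σ t) r0 - tent σ M s t rl| ≤ 1 / M := by
  have hM : (0 : ℝ) < M := by exact_mod_cast (show 0 < M by omega)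
  have h0' : (r0 : ℝ) = 0 := by exact_mod_cast h0
  have hl' : (rl : ℝ) = M - 1 := by
    have : ((rl : ℕ) : ℝ) + 1 = M := by exact_mod_cast hl
    linarith
  unfold tent
  rw [h0', hl']
  split_ifs <;>
  · rw [abs_le]; constructor <;> · field_simp; nlinarith [hM]

/-! ## §3 The same steps in `ℓ²(cubes)`: `Σ_s (Δφ_s)² ≤ 2∕M²` -/

/-- a family vanishing off `{t, σt}` with entries of modulus `≤ 1∕M` has `Σ_s f_s² ≤ 2∕M²`. [folklore] -/
theorem sum_sq_le_two_div_sq [Fintype ι] (σ : ι ≃ ι) (t : ι) (f : ι → ℝ) {M' : ℝ}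
    (hvan : ∀ s, t ≠ s → σ t ≠ s → f s = 0) (hbd : ∀ s, |f s| ≤ 1 / M') :
    ∑ s, f s ^ 2 ≤ 2 / M' ^ 2 := by
  classical
  have hsub : ∀ s, s ∉ ({t, σ t} : Finset ι) → f s ^ 2 = 0 := by
    intro s hs
    rw [Finset.mem_insert, Finset.mem_singleton, not_or] at hs
    rw [hvan s (Ne.symm hs.1) (Ne.symm hs.2), zero_pow two_ne_zero]
  rw [← Finset.sum_subset (Finset.subset_univ {t, σ t}) fun s _ hs => hsub s hs]
  have hterm : ∀ s, f s ^ 2 ≤ (1 / M') ^ 2 := fun s => by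
    rw [← sq_abs]; exact pow_le_pow_left₀ (abs_nonneg _) (hbd s) 2
  calc ∑ s ∈ ({t, σ t} : Finset ι), f s ^ 2 ≤ ∑ _s ∈ ({t, σ t} : Finset ι), (1 / M') ^ 2 := Finset.sum_le_sum fun s _ => hterm s
    _ = ({t, σ t} : Finset ι).card * (1 / M') ^ 2 := by rw [Finset.sum_const, nsmul_eq_mul]
    _ ≤ 2 * (1 / M') ^ 2 := by
        refine mul_le_mul_of_nonneg_right ?_ (sq_nonneg _)
        exact_mod_cast (Finset.card_insert_le _ _).trans (by simp)
    _ = 2 / M' ^ 2 := by rw [div_pow, one_pow, mul_one_div]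

/-- **A STEP INSIDE A BLOCK, IN `ℓ²(cubes)`**: `Σ_s (φ_s(t, r+1) − φ_s(t, r))² ≤ 2∕M²`. [folklore] -/
theorem sum_sq_tent_step_within [Fintype ι] (σ : ι ≃ ι) (t : ι) (r r' : Fin M) (h : (r' : ℕ) = r + 1) :
    ∑ s, (tent σ M s t r' - tent σ M s t r) ^ 2 ≤ 2 / (M : ℝ) ^ 2 := by
  refine sum_sq_le_two_div_sq σ t _ (fun s h1 h2 => ?_) fun s => abs_tent_step_within σ s t r r' h
  rw [tent_eq_zero_of_ne σ h1 h2, tent_eq_zero_of_ne σ h1 h2, sub_zero]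

/-- **A STEP ACROSS A BLOCK BOUNDARY, IN `ℓ²(cubes)`**: `Σ_s (φ_s(σt, 0) − φ_s(t, M−1))² ≤ 2∕M²` (the weights alive at either end are among `{t, σt, σσt}`;
but `φ_s(σt, 0) = [σt = s]` kills `σσt`, so the support is still `{t, σt}`). [folklore] -/
theorem sum_sq_tent_step_across [Fintype ι] (σ : ι ≃ ι) (t : ι) (r0 rl : Fin M) (h0 : (r0 : ℕ) = 0) (hl : (rl : ℕ) + 1 = M) :
    ∑ s, (tent σ M s (σ t) r0 - tent σ M s t rl) ^ 2 ≤ 2 / (M : ℝ) ^ 2 := by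
  have h0' : (r0 : ℝ) = 0 := by exact_mod_cast h0
  refine sum_sq_le_two_div_sq σ t _ (fun s h1 h2 => ?_) fun s => abs_tent_step_across σ s t r0 rl h0 hl
  rw [tent_eq_zero_of_ne σ h1 h2, sub_zero]
  unfold tent
  rw [if_neg h2, h0', zero_div]
  split_ifs <;> simp

/-! ## §4 Toy: two blocks of two sites, `σ = swap` -/

example (t : Fin 2) (r : Fin 2) : ∑ s, tent (Equiv.swap (0 : Fin 2) 1) 2 s t r = 1 := tent_sum _ t r

end Summit.QuantumFields.BalabanUV.T4Continuum.NE7b.TentPartitionChain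

end
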